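import Summits.ValiantsHypothesis.ValiantsHypothesis.Theorems.FifoMatchingNNDivisionHardExactPencilStickOut
import HarnessLib

/-! # Exact pencils II-b (val-idea-38 g3; crux `FifoMatching.NNDivisionHard`, stmt-ValiantsHypothesis-21181) — STICK-OUT / FAT CUBES AT POLYLOG SCALE

Successor workfile of `ExactPencil38.lean` (val-idea-38 g2, REV 18 FINAL @b2086f926775, at the 200 000 B cap).  Imports the LANDED D1 Theorems
port of rev 18 (`…Theorems.FifoMatching.ExactPencil`, parts 1–13, port staged by val-idea-40 g6, pressed by val-port-4; part 13
`…ExactPencilWindow` carries `T_lt_of_block_uniform`, part 11 `…PairsRead` carries ★★★ `cor_add_bound_of_edgesReadD`) AND D1 part 14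
`…ExactPencilStickOut` (✓ p690741) = this seat's §13b (stick-out / fat cubes at polylog scale), which is therefore only INDEXED here, not restated.

CONTENT.  §13b (= part 14, imported): the CUBE INSTANCE of rev 16's EDGE-FORM engine at the finest located pair `(Z, β) = (ιᶜ, singletons on ι)`:
* the CUBE CONE CERTIFICATE `sum_sub_sum_eq_sum_flips` (`q_{P'} − q_P = Σ_t 𝟙[t ∈ P ∆ P']·(q_{P∆{t}} − q_P)`: flip exactly the generators
  in `P ∆ P'`), `cube_hcone`; the edge reads `cube_hw` (an edge moves by `∓ G t`, read by `Es x y` with `x ∉ ι ∨ y ∉ ι`, `Es_faceZeroD id ιᶜ`);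
* ★★★ `cor_add_bound_of_stickOutCube : (∀ t, G t ≠ 0 → ∃ x y, G t x y ≠ 0 ∧ (x ∉ ι ∨ y ∉ ι)) → HasEFOfSize (COR(n) + cube) r → 3^{|ι|} ≤ (r+1)·2^{|ι|}`
  (:= `cor_add_bound_of_edgesReadD (β := id) (σ := id) … ιᶜ (cubeQ Q₀ G) cubeNbr (cube_hcone …) (cube_hw …)`), and the same in C′'s literal
  law-body currency `exactTilted_lawBody_stickOutCube`;
* ★★★ rates, EVERY `n` with `K(c,n) := 2(log₂ n + c)^c + 6 ≤ n`, budget-free, ANY number of generators, no symmetry asked: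
  `cor_add_stickOutCube_decided` (`|ι| ≥ K(c,n)` ⇒ `T c n < r`), `cor_add_fatCube_decided` (NO nonzero generator fits inside a `K(c,n) × K(c,n)`
  principal block ⇒ decided), `cor_add_fatColumnsCube_decided` / `cor_add_fatRowsCube_decided` (every nonzero generator has MORE THAN `K(c,n)`
  nonzero columns / rows ⇒ decided) — i.e. the `cubeFat` threshold of val-idea-43 g6's S43-4 (`Symmetry43.lean` rev 3 §B5, scale `⌊√h⌋`)
  is POLYLOG in flat currency.
* §13c ★★★ (E1) FOR CUBES IN KERNEL: four explicit `faceZeroD` reader families at ANY located pair `(Z, β)` — dead entries (rev 14),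
  ROW MOVES `E_{xy} − E_{x'y}` (`β x = β x'`), COLUMN MOVES, TRANSPOSE MOVES — `read_of_offT`, ★★★ `cor_add_bound_of_readCube` /
  `cor_add_bound_of_cube_offT : 3^{k−|D|} ≤ (r+1)·2^{k−|D|}` unless some nonzero generator is zero on dead rows/columns, block-constant
  and symmetric (= `T(Z,β)` in coordinates; crit-9 V#113b (E-5‴)/(E1) verbatim); ★★★ `cor_add_fewGenCube_decided`: EVERY cube with
  `N ≤ n − K(c,n)` generators is decided, no hypothesis on the generators (hitting set of rows + §13b).
CONSEQUENCES (bus 2026-08-29 val-idea-38 g3 (C); memo `ExactPencil38.md` §2g (E1)): V#109's T0 family `Σ_{|S|=s₀} [0, 𝟙_S𝟙_Sᵀ]` (`s₀ = ⌈√h/K⌉`)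
and its diagonal shadow are DECIDED outright; (E-5) holds at every scale `ℓ ≥ K(c,n)`; with the ZONOTOPE CLOSURE LEMMA (paper, bus (C)(3)) every
cube with `≤ 2^{n/(2K(c,n)) − 2}` generators is decided.
HONEST LABEL: instance theorems (DECIDED SPECIES) of the OPEN law C′ = `LocatedRows.ExactPencilLaw`; the crux 21181 `NNDivisionHard`, C′,
COR-VIRTUAL (`CorVirtualHardN`) and `CoreLawOrb` are OPEN; 0 enemies in sight.  VP ≠ VNP is NOT proved here or anywhere in this tree.
-/

set_option autoImplicit false

-- the mandated summit-side namespace repeats a component by design (single-problem summit)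
set_option linter.dupNamespace false

noncomputable section

open Matrix Finset
open scoped Pointwise

namespace Summit.ValiantsHypothesis.ValiantsHypothesis.Cruxes.NNDivisionHard.ExactPencilB

open Literature.Barriers.PneNP (HasEFOfSize)
open Literature.Combinatorics.Optimization.FixedSizePsdRank (corPolytope flat)
open Summit.ValiantsHypothesis.ValiantsHypothesis.Theorems.FifoMatching.XcDivision (udPt)
open Summit.ValiantsHypothesis.ValiantsHypothesis.Theorems.FifoMatching.LocatedRows (T exactTilted cubePt flat_add' flat_sum')
open Summit.ValiantsHypothesis.ValiantsHypothesis.Theorems.FifoMatching.ExactPencil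

/-! §13b (`section StickOut`: `cubeQ`, `cubeNbr`, `cube_hcone`, `cube_hw`, ★★★ `cor_add_bound_of_stickOutCube`, `exactTilted_lawBody_stickOutCube`,
`cor_add_stickOutCube_decided`, `cor_add_fatCube_decided`, `cor_add_fatColumnsCube_decided`, `cor_add_fatRowsCube_decided`) is NOT restated here: it is
D1 part 14 `…Theorems.FifoMatchingNNDivisionHardExactPencilStickOut` (this seat's `StickOut38_section.lean` b98220aa14e44726 verbatim, staged by val-idea-40 g6,
desk #433, ✓ p690741), imported above. -/

/-! ### §13c (val-idea-38 g3) (E1) IN KERNEL FOR CUBES — four explicit reader families at a located pair `(Z, β)`: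
DEAD ENTRIES `E_{xy}` (`β x ∈ D ∨ β y ∈ D`, rev 14), ROW MOVES `E_{xy} − E_{x'y}` (`β x = β x'`), COLUMN MOVES `E_{xy} − E_{xy'}`
(`β y = β y'`), TRANSPOSE MOVES `E_{xy} − E_{yx}` — all `faceZeroD β D`.  A cube is decided at `(Z, β)` (`3^{k−|D|} ≤ (r+1)·2^{k−|D|}`)
unless some nonzero generator is UNREAD by all four, i.e. is zero on dead rows/columns, row- and column-constant inside every block and
symmetric = a member of `T(Z,β) = span{udPt (bUn β S) : S live}` in coordinates (crit-9 V#113b (E-5‴)/(E1) verbatim).  Corollary with NO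
hypothesis on the generators: ★★★ `cor_add_fewGenCube_decided` — every cube with `N ≤ n − K(c,n)` generators is decided (hitting set of rows). -/

section ReadCube

variable {n : ℕ}

open Summit.ValiantsHypothesis.ValiantsHypothesis.Theorems.FifoMatching.LocatedRows (flat_sub')

/-- ROW MOVE reader: `E_{xy} − E_{x'y}` is `D`-face-zero whenever `x, x'` lie in a common block (live or dead). -/
theorem rowMove_faceZeroD {k : ℕ} (β : Fin n → Fin k) (D : Finset (Fin k)) {x x' : Fin n} (y : Fin n) (h : β x = β x') :
    faceZeroD β D (Es x y - Es x' y) := by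
  intro S _
  rw [flat_sub', sub_dotProduct, flat_Es_dotProduct_udPt, flat_Es_dotProduct_udPt]
  have hxx' : (x ∈ bUn β S ↔ x' ∈ bUn β S) := by rw [mem_bUn, mem_bUn, h]
  by_cases hx : x ∈ bUn β S
  · rw [if_pos hx, if_pos (hxx'.mp hx), sub_self]
  · rw [if_neg hx, if_neg (fun h' => hx (hxx'.mpr h')), sub_self]

/-- the row move reads `g x y − g x' y`. -/
theorem rowMove_read (x x' y : Fin n) (g : Matrix (Fin n) (Fin n) ℝ) :
    flat (Es x y - Es x' y) ⬝ᵥ flat g = g x y - g x' y := by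
  rw [flat_sub', sub_dotProduct, flat_Es_dotProduct_flat, flat_Es_dotProduct_flat]

/-- COLUMN MOVE reader: `E_{xy} − E_{xy'}` is `D`-face-zero whenever `y, y'` lie in a common block. -/
theorem colMove_faceZeroD {k : ℕ} (β : Fin n → Fin k) (D : Finset (Fin k)) (x : Fin n) {y y' : Fin n} (h : β y = β y') :
    faceZeroD β D (Es x y - Es x y') := by
  intro S _
  rw [flat_sub', sub_dotProduct, flat_Es_dotProduct_udPt, flat_Es_dotProduct_udPt]
  have hyy' : (y ∈ bUn β S ↔ y' ∈ bUn β S) := by rw [mem_bUn, mem_bUn, h]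
  by_cases hx : x ∈ bUn β S
  · by_cases hy : y ∈ bUn β S
    · simp only [if_pos hx, if_pos hy, if_pos (hyy'.mp hy), sub_self]
    · simp only [if_pos hx, if_neg hy, if_neg (fun h' => hy (hyy'.mpr h')), sub_self]
  · simp only [if_neg hx, sub_self]

/-- the column move reads `g x y − g x y'`. -/
theorem colMove_read (x y y' : Fin n) (g : Matrix (Fin n) (Fin n) ℝ) :
    flat (Es x y - Es x y') ⬝ᵥ flat g = g x y - g x y' := by
  rw [flat_sub', sub_dotProduct, flat_Es_dotProduct_flat, flat_Es_dotProduct_flat]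

/-- TRANSPOSE MOVE reader: `E_{xy} − E_{yx}` is `D`-face-zero for every `β`, `D`. -/
theorem transposeMove_faceZeroD {k : ℕ} (β : Fin n → Fin k) (D : Finset (Fin k)) (x y : Fin n) :
    faceZeroD β D (Es x y - Es y x) := by
  intro S _
  rw [flat_sub', sub_dotProduct, flat_Es_dotProduct_udPt, flat_Es_dotProduct_udPt]
  by_cases hx : x ∈ bUn β S
  · by_cases hy : y ∈ bUn β S
    · rw [if_pos hx, if_pos hy, if_pos hy, if_pos hx, sub_self]
    · rw [if_pos hx, if_neg hy, if_neg hy, sub_self]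
  · by_cases hy : y ∈ bUn β S
    · rw [if_neg hx, if_pos hy, if_neg hx, sub_self]
    · rw [if_neg hx, if_neg hy, sub_self]

/-- the transpose move reads `g x y − g y x`. -/
theorem transposeMove_read (x y : Fin n) (g : Matrix (Fin n) (Fin n) ℝ) :
    flat (Es x y - Es y x) ⬝ᵥ flat g = g x y - g y x := by
  rw [flat_sub', sub_dotProduct, flat_Es_dotProduct_flat, flat_Es_dotProduct_flat]

/-- ★ OFF-`T(Z,β)` ⇒ READ: a matrix with a nonzero dead entry, or two unequal rows in a common block, or two unequal columns in a
common block, or an asymmetry, is read by a `D`-face-zero reader. -/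
theorem read_of_offT {k : ℕ} (β : Fin n → Fin k) (D : Finset (Fin k)) (g : Matrix (Fin n) (Fin n) ℝ)
    (h : (∃ x y, g x y ≠ 0 ∧ (β x ∈ D ∨ β y ∈ D)) ∨ (∃ x x' y, β x = β x' ∧ g x y ≠ g x' y) ∨
      (∃ x y y', β y = β y' ∧ g x y ≠ g x y') ∨ (∃ x y, g x y ≠ g y x)) :
    ∃ U, faceZeroD β D U ∧ flat U ⬝ᵥ flat g ≠ 0 := by
  rcases h with ⟨x, y, hg, hd⟩ | ⟨x, x', y, hb, hg⟩ | ⟨x, y, y', hb, hg⟩ | ⟨x, y, hg⟩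
  · exact ⟨Es x y, Es_faceZeroD β D hd, by rwa [flat_Es_dotProduct_flat]⟩
  · exact ⟨Es x y - Es x' y, rowMove_faceZeroD β D y hb, by rwa [rowMove_read, sub_ne_zero]⟩
  · exact ⟨Es x y - Es x y', colMove_faceZeroD β D x hb, by rwa [colMove_read, sub_ne_zero]⟩
  · exact ⟨Es x y - Es y x, transposeMove_faceZeroD β D x y, by rwa [transposeMove_read, sub_ne_zero]⟩

/-- a read generator makes both of its flips read. -/
theorem cube_hw_of_read {k N : ℕ} (β : Fin n → Fin k) (D : Finset (Fin k)) (Q₀ : Matrix (Fin n) (Fin n) ℝ)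
    (G : Fin N → Matrix (Fin n) (Fin n) ℝ) (hG : ∀ t, G t ≠ 0 → ∃ U, faceZeroD β D U ∧ flat U ⬝ᵥ flat (G t) ≠ 0) :
    ∀ P, ∀ e ∈ cubeNbr P, cubeQ Q₀ G e ≠ cubeQ Q₀ G P →
      ∃ U, faceZeroD β D U ∧ flat U ⬝ᵥ flat (cubeQ Q₀ G e - cubeQ Q₀ G P) ≠ 0 := by
  intro P e he hne
  unfold cubeNbr at he
  obtain ⟨t, -, rfl⟩ := Finset.mem_image.1 he
  have hd := cubeQ_flip_sub Q₀ G P t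
  have hGt : G t ≠ 0 := by
    intro h0
    apply hne
    rw [← sub_eq_zero, hd, h0, neg_zero, ite_self]
  obtain ⟨U, hU, hne'⟩ := hG t hGt
  refine ⟨U, hU, ?_⟩
  rw [hd]
  split_ifs
  · have hneg : flat (-G t) = -flat (G t) := by
      funext p; simp [flat, Matrix.neg_apply]
    rw [hneg, dotProduct_neg]
    exact neg_ne_zero.2 hne'
  · exact hne'

/-- ★★★ **READ CUBES ARE DECIDED AT `(Z, β)`**: if every nonzero generator is read by some `D`-face-zero reader, then
`3^{k−|D|} ≤ (r+1)·2^{k−|D|}` for every EF of size `r` of `COR(n) + cube` (★★★ `cor_add_bound_of_edgesReadD` + the cube cone certificate). -/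
theorem cor_add_bound_of_readCube {k N : ℕ} {β : Fin n → Fin k} {σ : Fin k → Fin n} (hβσ : ∀ i, β (σ i) = i) (D : Finset (Fin k))
    (Q₀ : Matrix (Fin n) (Fin n) ℝ) (G : Fin N → Matrix (Fin n) (Fin n) ℝ)
    (hG : ∀ t, G t ≠ 0 → ∃ U, faceZeroD β D U ∧ flat U ⬝ᵥ flat (G t) ≠ 0) (r : ℕ)
    (hEF : HasEFOfSize (corPolytope n + convexHull ℝ (Set.range (cubePt Q₀ G))) r) :
    3 ^ (k - D.card) ≤ (r + 1) * 2 ^ (k - D.card) := by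
  rw [cubePt_eq_flat_cubeQ] at hEF
  exact cor_add_bound_of_edgesReadD hβσ D (cubeQ Q₀ G) cubeNbr (cube_hcone Q₀ G) (cube_hw_of_read β D Q₀ G hG) r hEF

/-- ★★★ **(E1) FOR CUBES, IN KERNEL**: a cube all of whose nonzero generators are OFF `T(Z,β)` — each has a nonzero dead entry, or two
unequal rows in a common block, or two unequal columns in a common block, or is not symmetric — is decided at `(Z, β)`.  Contrapositive =
crit-9 (E-5‴)/(E1): an undecided cube carries a nonzero generator that is zero on dead rows/columns, block-constant and symmetric. -/
theorem cor_add_bound_of_cube_offT {k N : ℕ} {β : Fin n → Fin k} {σ : Fin k → Fin n} (hβσ : ∀ i, β (σ i) = i) (D : Finset (Fin k))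
    (Q₀ : Matrix (Fin n) (Fin n) ℝ) (G : Fin N → Matrix (Fin n) (Fin n) ℝ)
    (hG : ∀ t, G t ≠ 0 → (∃ x y, G t x y ≠ 0 ∧ (β x ∈ D ∨ β y ∈ D)) ∨ (∃ x x' y, β x = β x' ∧ G t x y ≠ G t x' y) ∨
      (∃ x y y', β y = β y' ∧ G t x y ≠ G t x y') ∨ (∃ x y, G t x y ≠ G t y x)) (r : ℕ)
    (hEF : HasEFOfSize (corPolytope n + convexHull ℝ (Set.range (cubePt Q₀ G))) r) :
    3 ^ (k - D.card) ≤ (r + 1) * 2 ^ (k - D.card) :=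
  cor_add_bound_of_readCube hβσ D Q₀ G (fun t ht => read_of_offT β D (G t) (hG t ht)) r hEF

/-- a nonzero matrix has a nonzero entry. -/
theorem exists_entry_ne_zero {g : Matrix (Fin n) (Fin n) ℝ} (hg : g ≠ 0) : ∃ x y, g x y ≠ 0 := by
  by_contra h
  simp only [not_exists, not_not] at h
  exact hg (Matrix.ext fun x y => by rw [h x y, Matrix.zero_apply])

/-- ★★★ **FEW GENERATORS ⇒ DECIDED** (no hypothesis on the generators): every affine cube passenger with `N ≤ n − K(c,n)` generators,
`K(c,n) = 2(log₂ n + c)^c + 6`, is decided — `T c n < r` for every EF of `COR(n) + cube`.  Proof: one row index per nonzero generator is a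
hitting set `Z` with `|Z| ≤ N`; every nonzero generator sticks out of `ι × ι`, `ι = Zᶜ`, `|ι| ≥ n − N ≥ K(c,n)`; ★★★ `cor_add_stickOutCube_decided`. -/
theorem cor_add_fewGenCube_decided (c : ℕ) {N : ℕ} (hN : N + (2 * (Nat.log 2 n + c) ^ c + 6) ≤ n)
    (Q₀ : Matrix (Fin n) (Fin n) ℝ) (G : Fin N → Matrix (Fin n) (Fin n) ℝ) (r : ℕ)
    (hEF : HasEFOfSize (corPolytope n + convexHull ℝ (Set.range (cubePt Q₀ G))) r) : T c n < r := by
  classical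
  have hn : 0 < n := by omega
  have hrow : ∀ t, ∃ x : Fin n, G t ≠ 0 → ∃ y, G t x y ≠ 0 := by
    intro t
    by_cases ht : G t = 0
    · exact ⟨⟨0, hn⟩, fun h => (h ht).elim⟩
    · obtain ⟨x, y, hxy⟩ := exists_entry_ne_zero ht
      exact ⟨x, fun _ => ⟨y, hxy⟩⟩
  choose row hrow using hrow
  set Z : Finset (Fin n) := Finset.univ.image row with hZ
  have hZcard : Z.card ≤ N := by
    calc Z.card ≤ (Finset.univ : Finset (Fin N)).card := Finset.card_image_le
      _ = N := by rw [Finset.card_univ, Fintype.card_fin]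
  have hι : 2 * (Nat.log 2 n + c) ^ c + 6 ≤ Zᶜ.card := by
    rw [Finset.card_compl, Fintype.card_fin]
    omega
  refine cor_add_stickOutCube_decided c Zᶜ hι Q₀ G ?_ r hEF
  intro t ht
  obtain ⟨y, hy⟩ := hrow t ht
  refine ⟨row t, y, hy, Or.inl ?_⟩
  rw [Finset.mem_compl, not_not, hZ]
  exact Finset.mem_image_of_mem row (Finset.mem_univ t)

end ReadCube

end Summit.ValiantsHypothesis.ValiantsHypothesis.Cruxes.NNDivisionHard.ExactPencilB
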